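import Summits.CriticalPhenomena.PercolationContinuityZ3.Theorems.PercNearOneGluingNoHeavyLowerTailSahiE4UnionPairBlock
import Mathlib.Tactic.FinCases
import HarnessLib

/-!
# `NoHeavyLowerTail` (crux stmt-CriticalPhenomena-4575), Sahi programme P4, ORDER 4: two independent pair blocks — `E₄ ≥ 0` for
# `(a_0 ∨ b_0, a_1 ∨ b_1, a_2 ∨ c_2, a_3 ∨ c_3)` (the pair-block step iterated once, with the member relabelling made explicit)

Support file (cell `prim-l12`, seat P4, generation 34; `--supports stmt-CriticalPhenomena-4575`).  No definitions, no named facts, no sorries;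
standard axioms.  ILLUSTRATION of how `…SahiE4UnionPairBlock` iterates.  `γ, β, δ` finite distributive lattices with FKG probability weights
`μ, ν, ρ` [FortuinKasteleynGinibre1971; Sahi2008, eq. (8)]; `a : Fin 4 → γ → [0,1]` monotone with Sahi's `E₃ ≥ 0` for its four sub-triples and for the
two product triples `(a_0a_1,a_2,a_3)`, `(a_2a_3,a_0,a_1)`, and `E₄(a) ≥ 0` [Sahi2008, eq. (7); LiebSahi2021, Def. 3.1] (instances of `C₃`, `C₄` on `γ` —
e.g. increasing events on ≤ 5 coins); `b_0, b_1 : β → [0,1]` and `c_2, c_3 : δ → [0,1]` monotone, otherwise ARBITRARY.  Then on `γ × β × δ` with the product weight, the quadruple `(a_0 ⊕ b_0, a_1 ⊕ b_1, a_2 ⊕ c_2, a_3 ⊕ c_3)` (`x ⊕ y = x + y − xy`;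
unions of events) has `E₄ ≥ 0` (`sahiE_four_twoPairBlocks_nonneg`).  Proof: the pair-block step for `(b_0,b_1)` gives all of `H₄⁺` for
`u = (a_0⊕b_0, a_1⊕b_1, a_2, a_3)` on `γ × β` (again an FKG lattice, `isFKGMeasure_prod`); relabel members by `(0 2)(1 3)` (`sahiE_comp_perm`,
`sahiE_three_swap01/12`) and apply the step again for `(c_2,c_3)`.  HONEST FRAMING: blocks feeding three or four members are not covered. [this work]
-/

noncomputable section

namespace Summit.CriticalPhenomena.PercolationContinuityZ3.Theorems.SahiE4UnionPairBlock

open Finset Function Literature.Combinatorics.Sahi2008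
open Summit.CriticalPhenomena.PercolationContinuityZ3.Theorems.SahiE3UnionTensor (isFKGMeasure_prod sum_prodWeight)

variable {γ β δ : Type*} [Fintype γ] [Fintype β] [Fintype δ]

omit [Fintype γ] [Fintype β] in
/-- The OR slot of two monotone `[0,1]`-functions on a product of preorders is monotone and `[0,1]`-valued. [this work] -/
theorem orSlot_facts [Preorder γ] [Preorder β] {f : γ → ℝ} {g : β → ℝ} (hf0 : ∀ x, 0 ≤ f x) (hf1 : ∀ x, f x ≤ 1) (hfm : Monotone f)
    (hg0 : ∀ y, 0 ≤ g y) (hg1 : ∀ y, g y ≤ 1) (hgm : Monotone g) :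
    (∀ p : γ × β, 0 ≤ f p.1 + g p.2 - f p.1 * g p.2) ∧ (∀ p : γ × β, f p.1 + g p.2 - f p.1 * g p.2 ≤ 1) ∧
      Monotone (fun p : γ × β => f p.1 + g p.2 - f p.1 * g p.2) := by
  refine ⟨fun p => ?_, fun p => ?_, fun p q hpq => ?_⟩
  · nlinarith [hf0 p.1, hf1 p.1, hg0 p.2, hg1 p.2, mul_nonneg (hf0 p.1) (sub_nonneg.2 (hg1 p.2))]
  · nlinarith [mul_nonneg (sub_nonneg.2 (hf1 p.1)) (sub_nonneg.2 (hg1 p.2))]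
  · have h1 : f p.1 ≤ f q.1 := hfm hpq.1
    have h2 : g p.2 ≤ g q.2 := hgm hpq.2
    nlinarith [mul_le_mul (sub_le_sub_left h1 1) (sub_le_sub_left h2 1) (sub_nonneg.2 (hg1 q.2)) (sub_nonneg.2 (hf1 p.1)), hf1 q.1, hg1 p.2]

/-- **Two independent pair blocks.**  See the module docstring. [this work] -/
theorem sahiE_four_twoPairBlocks_nonneg [DistribLattice γ] [DistribLattice β] [DistribLattice δ]
    {μ : γ → ℝ} {ν : β → ℝ} {ρ : δ → ℝ} (hμ : IsFKGMeasure μ) (hν : IsFKGMeasure ν) (hρ : IsFKGMeasure ρ)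
    (a : Fin 4 → γ → ℝ) (ha0 : ∀ i t, 0 ≤ a i t) (ha1 : ∀ i t, a i t ≤ 1) (ham : ∀ i, Monotone (a i))
    (b0 b1 : β → ℝ) (hb00 : ∀ t, 0 ≤ b0 t) (hb01 : ∀ t, b0 t ≤ 1) (hb0m : Monotone b0)
    (hb10 : ∀ t, 0 ≤ b1 t) (hb11 : ∀ t, b1 t ≤ 1) (hb1m : Monotone b1)
    (c2 c3 : δ → ℝ) (hc20 : ∀ t, 0 ≤ c2 t) (hc21 : ∀ t, c2 t ≤ 1) (hc2m : Monotone c2)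
    (hc30 : ∀ t, 0 ≤ c3 t) (hc31 : ∀ t, c3 t ≤ 1) (hc3m : Monotone c3)
    (he012 : 0 ≤ sahiE μ 3 ![a 0, a 1, a 2]) (he013 : 0 ≤ sahiE μ 3 ![a 0, a 1, a 3]) (he023 : 0 ≤ sahiE μ 3 ![a 0, a 2, a 3])
    (he123 : 0 ≤ sahiE μ 3 ![a 1, a 2, a 3])
    (hp01 : 0 ≤ sahiE μ 3 ![a 0 * a 1, a 2, a 3]) (hp23 : 0 ≤ sahiE μ 3 ![a 2 * a 3, a 0, a 1])
    (he4 : 0 ≤ sahiE μ 4 a) :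
    0 ≤ sahiE (fun q : (γ × β) × δ => μ q.1.1 * ν q.1.2 * ρ q.2) 4
      ![(fun q : (γ × β) × δ => a 0 q.1.1 + b0 q.1.2 - a 0 q.1.1 * b0 q.1.2), (fun q : (γ × β) × δ => a 1 q.1.1 + b1 q.1.2 - a 1 q.1.1 * b1 q.1.2),
        (fun q : (γ × β) × δ => a 2 q.1.1 + c2 q.2 - a 2 q.1.1 * c2 q.2), (fun q : (γ × β) × δ => a 3 q.1.1 + c3 q.2 - a 3 q.1.1 * c3 q.2)] := by
  -- the first block
  have hμ0 := hμ.nonneg; have hμ1 := hμ.sum_eq_one; have hν0 := hν.nonneg; have hν1 := hν.sum_eq_one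
  have hρ0 := hρ.nonneg; have hρ1 := hρ.sum_eq_one
  have hμ2 : SahiPositive μ 2 := sahiPositive_two hμ
  have hν2 : SahiPositive ν 2 := sahiPositive_two hν
  have hρ2 : SahiPositive ρ 2 := sahiPositive_two hρ
  set b : Fin 4 → β → ℝ := ![b0, b1, (fun _ => (0:ℝ)), (fun _ => (0:ℝ))] with hb
  have hb0 : ∀ i t, 0 ≤ b i t := fun i t => by fin_cases i <;> simp [hb, hb00 t, hb10 t]
  have hb1 : ∀ i t, b i t ≤ 1 := fun i t => by fin_cases i <;> simp [hb, hb01 t, hb11 t]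
  have hbm : ∀ i, Monotone (b i) := fun i => by fin_cases i <;> [exact hb0m; exact hb1m; exact monotone_const; exact monotone_const]
  have hbz2 : ∀ t, b 2 t = 0 := fun t => rfl
  have hbz3 : ∀ t, b 3 t = 0 := fun t => rfl
  -- the accumulated family u on γ × β and its H₄⁺
  set W : γ × β → ℝ := fun p => μ p.1 * ν p.2 with hW
  set u : Fin 4 → γ × β → ℝ := fun i p => a i p.1 + b i p.2 - a i p.1 * b i p.2 with hu
  have hWfkg : IsFKGMeasure W := isFKGMeasure_prod hμ hν
  have hW2 : SahiPositive W 2 := sahiPositive_two hWfkg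
  have hu0 : ∀ i p, 0 ≤ u i p := fun i p => (orSlot_facts (ha0 i) (ha1 i) (ham i) (hb0 i) (hb1 i) (hbm i)).1 p
  have hu1 : ∀ i p, u i p ≤ 1 := fun i p => (orSlot_facts (ha0 i) (ha1 i) (ham i) (hb0 i) (hb1 i) (hbm i)).2.1 p
  have hum : ∀ i, Monotone (u i) := fun i => (orSlot_facts (ha0 i) (ha1 i) (ham i) (hb0 i) (hb1 i) (hbm i)).2.2
  -- H₄⁺(u): the facts needed by the second step (members relabelled by (0 2)(1 3))
  have U4 : 0 ≤ sahiE W 4 u := pairBlock_e4 μ ν hμ0 hμ1 hν0 hν1 hμ2 hν2 a b ha0 ha1 ham hb0 hb1 hbm hbz2 hbz3 he123 he023 hp01 he4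
  have U012 := pairBlock_e3_012 μ ν hμ0 hμ1 hν0 hν1 hμ2 hν2 a b ha0 ha1 ham hb0 hb1 hbm hbz2 hbz3 he012
  have U013 := pairBlock_e3_013 μ ν hμ0 hμ1 hν0 hν1 hμ2 hν2 a b ha0 ha1 ham hb0 hb1 hbm hbz2 hbz3 he013
  have U23 := pairBlock_p3_23 μ ν hμ0 hμ1 hν0 hν1 hμ2 hν2 a b ha0 ha1 ham hb0 hb1 hbm hbz2 hbz3 hp23
  -- relabel: u' = (u 2, u 3, u 0, u 1)
  set u' : Fin 4 → γ × β → ℝ := ![u 2, u 3, u 0, u 1] with hu'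
  have hu'0 : ∀ i p, 0 ≤ u' i p := fun i p => by fin_cases i <;> exact hu0 _ p
  have hu'1 : ∀ i p, u' i p ≤ 1 := fun i p => by fin_cases i <;> exact hu1 _ p
  have hu'm : ∀ i, Monotone (u' i) := fun i => by fin_cases i <;> exact hum _
  have E123' : 0 ≤ sahiE W 3 ![u' 1, u' 2, u' 3] := by
    show 0 ≤ sahiE W 3 ![u 3, u 0, u 1]
    rw [sahiE_three_swap01, sahiE_three_swap12]; exact U013
  have E023' : 0 ≤ sahiE W 3 ![u' 0, u' 2, u' 3] := by
    show 0 ≤ sahiE W 3 ![u 2, u 0, u 1]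
    rw [sahiE_three_swap01, sahiE_three_swap12]; exact U012
  have P01' : 0 ≤ sahiE W 3 ![u' 0 * u' 1, u' 2, u' 3] := by
    show 0 ≤ sahiE W 3 ![u 2 * u 3, u 0, u 1]
    exact U23
  have E4' : 0 ≤ sahiE W 4 u' := by
    have h := sahiE_comp_perm W 4 ((Equiv.swap (0 : Fin 4) 2).trans (Equiv.swap (1 : Fin 4) 3)) u
    rw [show (fun i => u (((Equiv.swap (0 : Fin 4) 2).trans (Equiv.swap (1 : Fin 4) 3)) i)) = u' from
      funext fun i => by fin_cases i <;> rfl] at h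
    rw [h]; exact U4
  -- the second block c on δ, feeding members 0,1 of u'
  set c : Fin 4 → δ → ℝ := ![c2, c3, (fun _ => (0:ℝ)), (fun _ => (0:ℝ))] with hc
  have hc0 : ∀ i t, 0 ≤ c i t := fun i t => by fin_cases i <;> simp [hc, hc20 t, hc30 t]
  have hc1 : ∀ i t, c i t ≤ 1 := fun i t => by fin_cases i <;> simp [hc, hc21 t, hc31 t]
  have hcm : ∀ i, Monotone (c i) := fun i => by fin_cases i <;> [exact hc2m; exact hc3m; exact monotone_const; exact monotone_const]
  have hcz2 : ∀ t, c 2 t = 0 := fun t => rfl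
  have hcz3 : ∀ t, c 3 t = 0 := fun t => rfl
  have step2 := pairBlock_e4 W ρ hWfkg.nonneg hWfkg.sum_eq_one hρ0 hρ1 hW2 hρ2 u' c hu'0 hu'1 hu'm hc0 hc1 hcm hcz2 hcz3 E123' E023' P01' E4'
  -- relabel back: the family of step 2 is (v 2, v 3, v 0, v 1) for the target family v
  have hperm := sahiE_comp_perm (fun q : (γ × β) × δ => W q.1 * ρ q.2) 4 ((Equiv.swap (0 : Fin 4) 2).trans (Equiv.swap (1 : Fin 4) 3))
    ![(fun q : (γ × β) × δ => a 0 q.1.1 + b0 q.1.2 - a 0 q.1.1 * b0 q.1.2), (fun q : (γ × β) × δ => a 1 q.1.1 + b1 q.1.2 - a 1 q.1.1 * b1 q.1.2),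
      (fun q : (γ × β) × δ => a 2 q.1.1 + c2 q.2 - a 2 q.1.1 * c2 q.2), (fun q : (γ × β) × δ => a 3 q.1.1 + c3 q.2 - a 3 q.1.1 * c3 q.2)]
  rw [show (fun i => (![(fun q : (γ × β) × δ => a 0 q.1.1 + b0 q.1.2 - a 0 q.1.1 * b0 q.1.2),
      (fun q : (γ × β) × δ => a 1 q.1.1 + b1 q.1.2 - a 1 q.1.1 * b1 q.1.2), (fun q : (γ × β) × δ => a 2 q.1.1 + c2 q.2 - a 2 q.1.1 * c2 q.2),
      (fun q : (γ × β) × δ => a 3 q.1.1 + c3 q.2 - a 3 q.1.1 * c3 q.2)] : Fin 4 → (γ × β) × δ → ℝ)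
      (((Equiv.swap (0 : Fin 4) 2).trans (Equiv.swap (1 : Fin 4) 3)) i))
      = (fun (i : Fin 4) (q : (γ × β) × δ) => u' i q.1 + c i q.2 - u' i q.1 * c i q.2) from
      funext fun i => by
        fin_cases i
        · funext q; simp [hu', hc, hu, hb, Equiv.swap_apply_def]
        · funext q; simp [hu', hc, hu, hb, Equiv.swap_apply_def]
        · funext q; simp [hu', hc, hu, hb, Equiv.swap_apply_def]
        · funext q; simp [hu', hc, hu, hb, Equiv.swap_apply_def]] at hperm
  rw [← hperm]
  exact step2

end Summit.CriticalPhenomena.PercolationContinuityZ3.Theorems.SahiE4UnionPairBlock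

end
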